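import Summits.BirchSwinnertonDyer.BirchSwinnertonDyer.Theorems.KolyvaginRoadThreeZhangInductionOn
import HarnessLib

/-!
# Route `KolyvaginRoadThree`, deciding crux `ZhangSharpFrameAtThreeHL` (item stmt-BirchSwinnertonDyer-19574):
# W. Zhang's induction WITHOUT the hypothesis (A6⁰) above the bottom level — the Selmer parity at level `∅` alone
# drives it (cell `bsd-stepL`, seat `bsd-stepL-zhang3-p1` g6; `--supports stmt-BirchSwinnertonDyer-19574`, helper;
# companion of `KolyvaginRoadThreeZhangInductionOn.lean`, p455609)

HONEST FRAMING. Pure linear algebra over an arbitrary field; nothing about elliptic curves, Heegner points or `p = 3`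
is asserted; 0 defs, 0 facts, 0 `sorry`. PARTITION: O2@3 (B10) × A1 — none (composition engine; types nothing,
closes nothing).

WHAT CHANGES. The registered method skeletons of the crux (v2t `d2cc5d83`, koly's v2u) ask of stub A, besides the
rank-lowering shape (A1), the conjunct **(A6⁰) «at every (good) level of even cardinality the total canonical Selmer
rank is non-zero»** — at `p = 3` the slot of W. Zhang's Thm. 7.1 (root number `−1` + the RANK-ZERO CONVERSE for the
level-raised forms: R-SU3 + B♭ in the cell's memos), which is NOT in print. It is not needed. Along the induction
(proof of Thm. 9.1) the only levels visited are reached from `∅` by rank-lowering steps, and each (A1)-step lowers the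
`μ`-eigenrank by exactly one and keeps the `−μ`-eigenrank ((9.1)–(9.2)): so the TOTAL rank at a visited level `n` is
`r(∅) − #n`, and at the visited EVEN levels it is odd — in particular non-zero — as soon as `r(∅)` is odd. Formally:
run the relativised engine `exists_ne_zero_of_zhangInduction_on` on the finer predicate
`Good' n := Good n ∧ Odd (r(n) + #n)`; (A1) preserves it by the count above, (A2)–(A5) only weaken, and (A6) on
`Good'` even levels is AUTOMATIC. Hence:

* `exists_ne_zero_of_zhangInduction_on_of_odd` — (A1)–(A5) on good levels ⟹ a non-zero class at every good level `n`
  of even cardinality with `r(n) + #n` odd;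
* `exists_ne_zero_at_bottom_of_zhangInduction_on_of_odd` — the same at `∅`: **(A1)–(A5) + `Good ∅` + `Odd r(∅)` ⟹
  `∃ m, κ m ∅ ≠ 0`** — the shape a method skeleton's `_of` calls;
* `exists_ne_zero_at_bottom_of_zhangInduction_fin_of_odd` — all levels good.

At a Hoffstein–Luo frame of the crux `r(∅) = dim_{𝔽₃} Sel₃(E/K)` (zhang3-p1 g5 `Method2.finrank_selmer_eq_finrank_selQ_add`)
and ITS oddness is a consequence of PUBLISHED inputs only — `rank E(K) = 1` and `Ш(E/K)` finite (Gross–Zagier +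
Kolyvagin), `E(K)[3] = 0` (`ρ̄` irreducible), and the Cassels–Tate pairing (`dim_{𝔽₃} Ш(E/K)[3]` even; tree
`exists_selmerRank_eq_add`) — see the companion `KolyvaginRoadThreeMethod2Parity.lean`. So stub A of the method
skeleton can DROP (A6⁰): what remains of it is the rank-lowering shape (A1) alone.

References: [cite: WZhang2014, §9 proof of Thm. 9.1 (pp. 240–242) and Thm. 9.2].
-/

namespace Summit.BirchSwinnertonDyer.Rank1Residual.X11b.Three.Koly.ZhangInductionOn

open Module

variable {F : Type*} [Field F] {H : Type*} [AddCommGroup H] [Module F H]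
  {Q : Type*} [DecidableEq Q] {M : Type*}

omit [DecidableEq Q] in
/-- The total rank does not depend on which eigenspace is listed first. [folklore] -/
private theorem rank_symm' (Sel : Finset Q → Bool → Submodule F H) (n : Finset Q) (μ : Bool) :
    finrank F (Sel n μ) + finrank F (Sel n (!μ)) = finrank F (Sel n true) + finrank F (Sel n false) := by
  cases μ
  · rw [Bool.not_false, add_comm]
  · rw [Bool.not_true]

/-- **Zhang's induction on good levels, (A6) replaced by a parity COUNT.** Data and (A1)–(A5) as in
`exists_ne_zero_of_zhangInduction_on`; NO hypothesis (A6)/(A6⁰). Conclusion: at every good level `n` of even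
cardinality such that `dim Sel_n⁺ + dim Sel_n⁻ + #n` is odd, some class `κ m n` is non-zero. Proof: the relativised
engine run on `Good' n := Good n ∧ Odd (dim Sel_n⁺ + dim Sel_n⁻ + #n)`, which (A1) preserves (the `μ`-rank drops by
one, the `−μ`-rank is kept, the cardinality grows by one) and on whose even levels the total rank is odd for free.
[cite: WZhang2014, §9 proof of Thm. 9.1 and (9.1)–(9.2)] -/
theorem exists_ne_zero_of_zhangInduction_on_of_odd (Good : Finset Q → Prop)
    (Sel : Finset Q → Bool → Submodule F H) (SelRel : Finset Q → Set Q → Bool → Submodule F H)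
    (B : Finset Q → Set Q) (κ : M → Finset Q → H) (m₁ : M)
    -- (A1) rank lowering at a fresh prime, staying inside the good levels, eigen-bookkeeping (9.1)–(9.2)
    (hA1 : ∀ (n : Finset Q) (μ : Bool) (c : H), Good n → c ∈ Sel n μ → c ≠ 0 →
      ∃ q, q ∉ n ∧ Good (insert q n) ∧ c ∉ Sel (insert q n) μ ∧ Sel (insert q n) μ ≤ Sel n μ ∧
        finrank F (Sel (insert q n) μ) + 1 = finrank F (Sel n μ) ∧ Sel (insert q n) (!μ) = Sel n (!μ))
    -- (A2) cohomological congruence, contrapositive form, along two good lowering steps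
    (hA2 : ∀ (n : Finset Q) (q₁ q₂ : Q), Good n → Good (insert q₁ n) → Good (insert q₂ (insert q₁ n)) →
      q₁ ∉ n → q₂ ∉ insert q₁ n → q₂ ∉ B (insert q₂ (insert q₁ n)) → ∃ m, κ m n ≠ 0)
    -- (A3) triangulation at a good even level carrying a non-zero class (finiteness of the relaxed space included)
    (hA3 : ∀ (n : Finset Q), Good n → Even n.card → (∃ m, κ m n ≠ 0) →
      ∃ (s : Bool) (d : ℕ), finrank F (Sel n s) = d + 1 ∧ Sel n s = SelRel n (B n) s ∧
        FiniteDimensional F (SelRel n (B n) (!s)) ∧ finrank F (SelRel n (B n) (!s)) ≤ d)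
    -- (A4) relaxation: good levels n and n ∪ {q} differ only at q
    (hA4 : ∀ (n : Finset Q) (q : Q) (S : Set Q) (s : Bool), Good n → Good (insert q n) → q ∉ n → q ∈ S →
      Sel n s ≤ SelRel (insert q n) S s)
    -- (A5) base case at good even levels: Selmer rank one
    (hA5 : ∀ (n : Finset Q), Good n → Even n.card →
      finrank F (Sel n true) + finrank F (Sel n false) = 1 → κ m₁ n ≠ 0) :
    ∀ (n : Finset Q), Good n → Odd (finrank F (Sel n true) + finrank F (Sel n false) + n.card) → Even n.card →
      ∃ m, κ m n ≠ 0 := by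
  intro n hg hodd hn
  -- the finer predicate
  let Good' : Finset Q → Prop := fun n ↦ Good n ∧ Odd (finrank F (Sel n true) + finrank F (Sel n false) + n.card)
  refine exists_ne_zero_of_zhangInduction_on Good' Sel SelRel B κ m₁ ?_ ?_ ?_ ?_ ?_ ?_ n ⟨hg, hodd⟩ hn
  · -- (A1) preserves Good'
    intro n μ c hg' hc hc0
    obtain ⟨q, hqn, hgq, hcout, hle, hrk, hneg⟩ := hA1 n μ c hg'.1 hc hc0
    refine ⟨q, hqn, ⟨hgq, ?_⟩, hcout, hle, hrk, hneg⟩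
    have h1 := rank_symm' Sel n μ
    have h2 := rank_symm' Sel (insert q n) μ
    rw [hneg] at h2
    rw [Finset.card_insert_of_notMem hqn]
    obtain ⟨t, ht⟩ := hg'.2
    exact ⟨t, by omega⟩
  · exact fun n q₁ q₂ hg' hg₁ hg₂ ↦ hA2 n q₁ q₂ hg'.1 hg₁.1 hg₂.1
  · exact fun n hg' ↦ hA3 n hg'.1
  · exact fun n q S s hg' hgq ↦ hA4 n q S s hg'.1 hgq.1
  · exact fun n hg' ↦ hA5 n hg'.1
  · -- (A6) on Good' even levels is automatic
    intro n hg' hn'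
    obtain ⟨t, ht⟩ := hg'.2
    obtain ⟨u, hu⟩ := hn'
    exact ⟨t - u, by omega⟩

/-- **At the bottom level: (A1)–(A5) on good levels + `Good ∅` + ODD total Selmer rank at `∅` ⟹ a non-zero class
`κ m ∅`.** This is the engine a method skeleton's `_of` should call: its stub A then consists of the rank-lowering
shape (A1) only, and the parity input `Odd (dim Sel_∅⁺ + dim Sel_∅⁻)` is, at a Hoffstein–Luo frame,
`dim_{𝔽₃} Sel₃(E/K)` odd — a consequence of published inputs (companion file `KolyvaginRoadThreeMethod2Parity`).
[cite: WZhang2014, §9 proof of Thm. 9.1 and Thm. 9.2] -/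
theorem exists_ne_zero_at_bottom_of_zhangInduction_on_of_odd (Good : Finset Q → Prop) (hgood : Good ∅)
    (Sel : Finset Q → Bool → Submodule F H) (SelRel : Finset Q → Set Q → Bool → Submodule F H)
    (B : Finset Q → Set Q) (κ : M → Finset Q → H) (m₁ : M)
    (hA1 : ∀ (n : Finset Q) (μ : Bool) (c : H), Good n → c ∈ Sel n μ → c ≠ 0 →
      ∃ q, q ∉ n ∧ Good (insert q n) ∧ c ∉ Sel (insert q n) μ ∧ Sel (insert q n) μ ≤ Sel n μ ∧
        finrank F (Sel (insert q n) μ) + 1 = finrank F (Sel n μ) ∧ Sel (insert q n) (!μ) = Sel n (!μ))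
    (hA2 : ∀ (n : Finset Q) (q₁ q₂ : Q), Good n → Good (insert q₁ n) → Good (insert q₂ (insert q₁ n)) →
      q₁ ∉ n → q₂ ∉ insert q₁ n → q₂ ∉ B (insert q₂ (insert q₁ n)) → ∃ m, κ m n ≠ 0)
    (hA3 : ∀ (n : Finset Q), Good n → Even n.card → (∃ m, κ m n ≠ 0) →
      ∃ (s : Bool) (d : ℕ), finrank F (Sel n s) = d + 1 ∧ Sel n s = SelRel n (B n) s ∧
        FiniteDimensional F (SelRel n (B n) (!s)) ∧ finrank F (SelRel n (B n) (!s)) ≤ d)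
    (hA4 : ∀ (n : Finset Q) (q : Q) (S : Set Q) (s : Bool), Good n → Good (insert q n) → q ∉ n → q ∈ S →
      Sel n s ≤ SelRel (insert q n) S s)
    (hA5 : ∀ (n : Finset Q), Good n → Even n.card →
      finrank F (Sel n true) + finrank F (Sel n false) = 1 → κ m₁ n ≠ 0)
    (hodd : Odd (finrank F (Sel ∅ true) + finrank F (Sel ∅ false))) :
    ∃ m, κ m ∅ ≠ 0 :=
  exists_ne_zero_of_zhangInduction_on_of_odd Good Sel SelRel B κ m₁ hA1 hA2 hA3 hA4 hA5 ∅ hgood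
    (by rw [Finset.card_empty, add_zero]; exact hodd) (by simp)

/-- **All levels good: (A1)–(A5) + ODD total Selmer rank at `∅` ⟹ a non-zero class `κ m ∅`** (finiteness inside
(A3), as in `exists_ne_zero_of_zhangInduction_fin`). [cite: WZhang2014, §9 proof of Thm. 9.1 and Thm. 9.2] -/
theorem exists_ne_zero_at_bottom_of_zhangInduction_fin_of_odd
    (Sel : Finset Q → Bool → Submodule F H) (SelRel : Finset Q → Set Q → Bool → Submodule F H)
    (B : Finset Q → Set Q) (κ : M → Finset Q → H) (m₁ : M)
    (hA1 : ∀ (n : Finset Q) (μ : Bool) (c : H), c ∈ Sel n μ → c ≠ 0 →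
      ∃ q, q ∉ n ∧ c ∉ Sel (insert q n) μ ∧ Sel (insert q n) μ ≤ Sel n μ ∧
        finrank F (Sel (insert q n) μ) + 1 = finrank F (Sel n μ) ∧ Sel (insert q n) (!μ) = Sel n (!μ))
    (hA2 : ∀ (n : Finset Q) (q₁ q₂ : Q), q₁ ∉ n → q₂ ∉ insert q₁ n →
      q₂ ∉ B (insert q₂ (insert q₁ n)) → ∃ m, κ m n ≠ 0)
    (hA3 : ∀ (n : Finset Q), Even n.card → (∃ m, κ m n ≠ 0) →
      ∃ (s : Bool) (d : ℕ), finrank F (Sel n s) = d + 1 ∧ Sel n s = SelRel n (B n) s ∧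
        FiniteDimensional F (SelRel n (B n) (!s)) ∧ finrank F (SelRel n (B n) (!s)) ≤ d)
    (hA4 : ∀ (n : Finset Q) (q : Q) (S : Set Q) (s : Bool), q ∉ n → q ∈ S → Sel n s ≤ SelRel (insert q n) S s)
    (hA5 : ∀ (n : Finset Q), Even n.card → finrank F (Sel n true) + finrank F (Sel n false) = 1 → κ m₁ n ≠ 0)
    (hodd : Odd (finrank F (Sel ∅ true) + finrank F (Sel ∅ false))) :
    ∃ m, κ m ∅ ≠ 0 :=
  exists_ne_zero_at_bottom_of_zhangInduction_on_of_odd (fun _ ↦ True) trivial Sel SelRel B κ m₁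
    (fun n μ c _ hc hc0 ↦ by
      obtain ⟨q, h1, h2, h3, h4, h5⟩ := hA1 n μ c hc hc0
      exact ⟨q, h1, trivial, h2, h3, h4, h5⟩)
    (fun n q₁ q₂ _ _ _ ↦ hA2 n q₁ q₂) (fun n _ ↦ hA3 n) (fun n q S s _ _ ↦ hA4 n q S s) (fun n _ ↦ hA5 n) hodd

end Summit.BirchSwinnertonDyer.Rank1Residual.X11b.Three.Koly.ZhangInductionOn
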